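import Literature.MathematicalPhysics.QuantumLattice.XYZGroundStateOrderSpinHalfHolds
import Literature.MathematicalPhysics.QuantumLattice.XYZGroundStateOrderCorrIneq
import Literature.MathematicalPhysics.QuantumLattice.HeisenbergOrderNeelGD
import HarnessLib

/-!
# The Ising-component (density) infrared bound for the easy-plane XXZ ground state

For Björnberg–Ueltschi's nearest-neighbour Hamiltonian on the even torus `(ℤ/2kℤ)^d`,
`H₀ = anisotropicTorus d (2k) n 1 1 Δ = -Σ_{x,y adjacent} (SˣSˣ + SʸSʸ + Δ SᶻSᶻ)` (ferromagnetic XY,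
antiferromagnetic Ising for `Δ < 0`; for spin `½` this is twice the hard-core boson Hamiltonian
`H_M(Δ)` of the `HubbardSuperconductivity` routes), and its tracial ground-state functional `ω`,
the STAGGERED structure factor of the THIRD spin component obeys, for every momentum `q ≠ 0`,

`0 ≤ Ĉ_stag(q)` and `Ĉ_stag(q)² · E(q) ≤ (c_∥ / (4(-Δ))) · Σᵢ (1 + cos qᵢ)`,

`Ĉ_stag(q) = |Λ|⁻¹ Σ_{x,y} cos(q·(x-y)) (-1)^x (-1)^y Re ω(Sᶻ_x Sᶻ_y)`, `E(q) = Σᵢ(1 - cos qᵢ)`,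
`c_∥ = (d|Λ|)⁻¹ Σ_x Σᵢ Re ω(Sˣ_xSˣ_{x+eᵢ} + Sʸ_xSʸ_{x+eᵢ})` the planar nearest-neighbour correlation
(`xxz_isingStagStructureFactor_infraredBound`). Since `(-1)^x(-1)^y cos(q·(x-y)) = cos((q+Q)·(x-y))`
with `Q = (π,…,π)`, this says that the plain `zz` structure factor `Ĉ(p)`, `p = q + Q ≠ Q`, satisfies
`Ĉ(p)² (2d - E(p)) ≤ (c_∥/(4(-Δ))) E(p)`: the Ising (density, for hard-core bosons) structure factor
of the ground state is `O(|p|/√(-Δ))` UNIFORMLY IN THE VOLUME — the rigorous "finite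
compressibility" input of Pitaevskii–Stringari-type `T = 0` arguments
[cite: Stringari1995, §2.2 (10)–(11)], here supplied by reflection positivity.

Proof: the tree's Björnberg–Ueltschi machinery, in the OTHER admissible frame. The rotation by `π`
about the `1`-axis on the odd sublattice (`sublatticeOp_conj_anisotropicTorus`, Dyson–Lieb–Simon /
Kennedy–Lieb–Shastry) maps `H(1,1,Δ) ↦ H(1,-1,-Δ)`; the global frame rotation `V` (`VSᶻVᴴ = Sˣ`,
`globalOp_conj_anisotropicTorus`) maps `H(1,-1,-Δ) ↦ H(-Δ,-1,1) = (-Δ)·H(1, -1/(-Δ), 1/(-Δ))`, which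
is B–U's rotated Hamiltonian `anisotropicTorus d L n 1 J₂ J₁` with `J₁ = 1/(-Δ) ≥ 0 ≥ J₂ = -J₁`, so
ground-state Gaussian domination (`buSpinHalf_gaussianDomination`, B–U Cor. 5.3 at `β = ∞`) and
B–U's Lemma 4.4 at `β = ∞` (`xyz_infraredBound_of_groundEnergy_le`) apply; the composite unitary
carries the probed component `S⁰` of that frame onto `(-1)^x S²_x` of `H₀` and its bond
correlations onto `-⟨SʸSʸ⟩`, `⟨SˣSˣ⟩` of `H₀` (covariance of the tracial ground state,
`Matrix.groundStateFunctional_unitary_conj`, `Matrix.groundStateFunctional_smul_of_pos`).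
No definition is introduced; sorry-free.

## References

* [BjornbergUeltschi2022] J. E. Björnberg, D. Ueltschi, *Reflection positivity and infrared bounds
  for quantum spin systems*, arXiv:2204.12896, Prop. 2.4, Lemma 4.4, Lemma 5.2, Cor. 5.3.
* [KLS1988JSP] T. Kennedy, E. H. Lieb, B. S. Shastry, J. Stat. Phys. 53 (1988) 1019, eqs. (15)–(19).
* [DysonLiebSimon1978] F. J. Dyson, E. H. Lieb, B. Simon, J. Stat. Phys. 18 (1978) 335, §2, Thm. 4.2.
* [Stringari1995] S. Stringari, in: Bose–Einstein Condensation (CUP 1995), §2.2 (10)–(11).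
-/

noncomputable section

namespace Literature.MathematicalPhysics.QuantumLattice

open Matrix Finset Literature.Probability.LatticeModels
open scoped ComplexOrder

variable {d : ℕ}

/-- **Scaling the couplings scales the Hamiltonian**: `H(ta, tb, tc) = t·H(a,b,c)`. [folklore] -/
theorem anisotropicTorus_mul_left (L : ℕ) [NeZero L] (n : ℕ) (t a b c : ℝ) :
    anisotropicTorus d L n (t * a) (t * b) (t * c) = ((t : ℝ) : ℂ) • anisotropicTorus d L n a b c := by
  rw [anisotropicTorus_eq, anisotropicTorus_eq, smul_neg, Finset.smul_sum]
  congr 1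
  refine sum_congr rfl fun x _ => ?_
  rw [Finset.smul_sum]
  refine sum_congr rfl fun y _ => ?_
  split_ifs
  · simp only [Complex.ofReal_mul, smul_add, smul_smul]
  · rw [smul_zero]

/-- **The Ising-component infrared bound for the easy-plane XXZ ground state** (staggered form).
On the even torus `(ℤ/2kℤ)^d`, `k ≥ 2`, `d ≥ 1`, every spin `n/2`, every `Δ < 0` and every momentum
`q ≠ 0`: with `ω` the tracial ground-state functional of `H₀ = anisotropicTorus d (2k) n 1 1 Δ`,
`Ĉ_stag(q) := |Λ|⁻¹ Σ_{x,y} cos(q·(x-y)) (-1)^x(-1)^y Re ω(Sᶻ_xSᶻ_y)` satisfies `0 ≤ Ĉ_stag(q)` and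
`Ĉ_stag(q)² E(q) ≤ ((-Δ)⁻¹/4) · c_∥ · Σᵢ(1 + cos qᵢ)`,
`c_∥ = (d|Λ|)⁻¹ Σ_x Σᵢ Re ω(Sˣ_xSˣ_{x+eᵢ} + Sʸ_xSʸ_{x+eᵢ})`. (Björnberg–Ueltschi's Lemma 4.4 / Cor. 5.3
at `β = ∞` in the frame obtained from the sublattice half turn about the first axis followed by
the frame rotation `Sᶻ ↦ Sˣ`.) [cite: BjornbergUeltschi2022, Lemma 4.4 and Corollary 5.3]
[cite: KLS1988JSP, eqs. (15)–(19)] -/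
theorem xxz_isingStagStructureFactor_infraredBound (hd : 0 < d) (k : ℕ) [NeZero (2 * k)]
    (hk : 2 ≤ k) (n : ℕ) {Δ : ℝ} (hΔ : Δ < 0) (q : TorusSite d (2 * k)) (hq : q ≠ 0) :
    0 ≤ (∑ x : TorusSite d (2 * k), ∑ y : TorusSite d (2 * k),
          Real.cos (torusPhase (2 * k) q (x - y)) * (neelSign x * neelSign y *
            ((anisotropicTorus d (2 * k) n 1 1 Δ).groundStateFunctional
              (siteSpin n x 2 * siteSpin n y 2)).re)) / ((2 * k : ℕ) : ℝ) ^ d ∧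
    ((∑ x : TorusSite d (2 * k), ∑ y : TorusSite d (2 * k),
          Real.cos (torusPhase (2 * k) q (x - y)) * (neelSign x * neelSign y *
            ((anisotropicTorus d (2 * k) n 1 1 Δ).groundStateFunctional
              (siteSpin n x 2 * siteSpin n y 2)).re)) / ((2 * k : ℕ) : ℝ) ^ d) ^ 2 *
        dispersion (latticeMomentum (2 * k) q) ≤
      ((-Δ)⁻¹ / 4) *
        ((∑ x : TorusSite d (2 * k), ∑ i : Fin d,
            ((anisotropicTorus d (2 * k) n 1 1 Δ).groundStateFunctional
              (siteSpin n x 0 * siteSpin n (x + Pi.single i 1) 0 +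
                siteSpin n x 1 * siteSpin n (x + Pi.single i 1) 1)).re) /
          ((d : ℝ) * ((2 * k : ℕ) : ℝ) ^ d)) *
        ∑ i : Fin d, (1 + Real.cos (latticeMomentum (2 * k) q i)) := by
  -- sizes and couplings
  have hL3 : 3 ≤ 2 * k := by omega
  have hL4 : 4 ≤ 2 * k := by omega
  have hL2 : 2 ≤ 2 * k := by omega
  have hEven : Even (2 * k) := even_two_mul k
  have hΔ' : 0 < -Δ := by linarith
  set J : ℝ := (-Δ)⁻¹ with hJ_def
  have hJ : 0 < J := inv_pos.2 hΔ'
  have hΔJ : -Δ * J = 1 := mul_inv_cancel₀ hΔ'.ne'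
  set H₀ : Op (TorusSite d (2 * k)) (n + 1) := anisotropicTorus d (2 * k) n 1 1 Δ with hH₀_def
  set H' : Op (TorusSite d (2 * k)) (n + 1) := anisotropicTorus d (2 * k) n 1 (-J) J with hH'_def
  have hH' : H'.IsHermitian := anisotropicTorus_isHermitian (2 * k) n 1 (-J) J
  -- the single-site unitaries
  obtain ⟨V, hV, hV', hVz, hVx, hVy⟩ := exists_unitary_conj_spinZ_eq_spinX n
  obtain ⟨T, hT, hT', hTx, hTy, hTz⟩ := exists_halfTurn_x n
  -- the sublattice half turn `U` and the global frame rotation `R`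
  set par : TorusSite d (2 * k) → ZMod 2 := fun z =>
    ∑ j, ZMod.castHom (dvd_mul_right 2 k) (ZMod 2) (z j) with hpar
  set u : TorusSite d (2 * k) → Matrix (Fin (n + 1)) (Fin (n + 1)) ℂ := fun z =>
    if par z = 0 then 1 else T with hu
  set sgn : TorusSite d (2 * k) → ℂ := fun z => if par z = 0 then 1 else -1 with hsgn
  have hsgn_neel : ∀ z, sgn z = (neelSign z : ℂ) := fun z => by
    rw [neelSign_eq_ite k z]
  have hua : ∀ z, u z * (u z)ᴴ = 1 := by
    intro z; simp only [hu]; split_ifs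
    · rw [conjTranspose_one, Matrix.mul_one]
    · exact hT
  have hua' : ∀ z, (u z)ᴴ * u z = 1 := by
    intro z; simp only [hu]; split_ifs
    · rw [conjTranspose_one, Matrix.mul_one]
    · exact hT'
  -- adjoint single-site actions: `uᴴ Sˣ u = Sˣ`, `uᴴ Sʸ u = sgn·Sʸ`, `uᴴ Sᶻ u = sgn·Sᶻ`
  have hTx' : Tᴴ * spinX n * T = spinX n := by
    calc Tᴴ * spinX n * T = Tᴴ * (T * spinX n * Tᴴ) * T := by rw [hTx]
      _ = (Tᴴ * T) * spinX n * (Tᴴ * T) := by simp only [Matrix.mul_assoc]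
      _ = spinX n := by rw [hT', Matrix.one_mul, Matrix.mul_one]
  have hTy' : Tᴴ * spinY n * T = -spinY n := by
    have h : Tᴴ * (T * spinY n * Tᴴ) * T = spinY n := by
      calc Tᴴ * (T * spinY n * Tᴴ) * T = (Tᴴ * T) * spinY n * (Tᴴ * T) := by
            simp only [Matrix.mul_assoc]
        _ = spinY n := by rw [hT', Matrix.one_mul, Matrix.mul_one]
    rw [hTy, Matrix.mul_neg, Matrix.neg_mul] at h
    calc Tᴴ * spinY n * T = -(-(Tᴴ * spinY n * T)) := (neg_neg _).symm
      _ = -spinY n := by rw [h]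
  have hTz' : Tᴴ * SpinOperators.spinZ n * T = -SpinOperators.spinZ n := by
    have h : Tᴴ * (T * SpinOperators.spinZ n * Tᴴ) * T = SpinOperators.spinZ n := by
      calc Tᴴ * (T * SpinOperators.spinZ n * Tᴴ) * T
          = (Tᴴ * T) * SpinOperators.spinZ n * (Tᴴ * T) := by simp only [Matrix.mul_assoc]
        _ = SpinOperators.spinZ n := by rw [hT', Matrix.one_mul, Matrix.mul_one]
    rw [hTz, Matrix.mul_neg, Matrix.neg_mul] at h
    calc Tᴴ * SpinOperators.spinZ n * T = -(-(Tᴴ * SpinOperators.spinZ n * T)) := (neg_neg _).symm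
      _ = -SpinOperators.spinZ n := by rw [h]
  have hux' : ∀ z, (u z)ᴴ * spinX n * u z = spinX n := by
    intro z; simp only [hu]; split_ifs
    · rw [conjTranspose_one, Matrix.mul_one, Matrix.one_mul]
    · exact hTx'
  have huy' : ∀ z, (u z)ᴴ * spinY n * u z = sgn z • spinY n := by
    intro z; simp only [hu, hsgn]; split_ifs
    · rw [conjTranspose_one, Matrix.mul_one, Matrix.one_mul, one_smul]
    · rw [hTy', neg_one_smul]
  have huz' : ∀ z, (u z)ᴴ * SpinOperators.spinZ n * u z = sgn z • SpinOperators.spinZ n := by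
    intro z; simp only [hu, hsgn]; split_ifs
    · rw [conjTranspose_one, Matrix.mul_one, Matrix.one_mul, one_smul]
    · rw [hTz', neg_one_smul]
  -- adjoint actions of `V`: `Vᴴ Sˣ V = Sᶻ`, `Vᴴ Sʸ V = Sʸ`, `Vᴴ Sᶻ V = -Sˣ`
  have hVx' : Vᴴ * spinX n * V = SpinOperators.spinZ n := by
    calc Vᴴ * spinX n * V = Vᴴ * (V * SpinOperators.spinZ n * Vᴴ) * V := by rw [hVz]
      _ = (Vᴴ * V) * SpinOperators.spinZ n * (Vᴴ * V) := by simp only [Matrix.mul_assoc]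
      _ = SpinOperators.spinZ n := by rw [hV', Matrix.one_mul, Matrix.mul_one]
  have hVy' : Vᴴ * spinY n * V = spinY n := by
    calc Vᴴ * spinY n * V = Vᴴ * (V * spinY n * Vᴴ) * V := by rw [hVy]
      _ = (Vᴴ * V) * spinY n * (Vᴴ * V) := by simp only [Matrix.mul_assoc]
      _ = spinY n := by rw [hV', Matrix.one_mul, Matrix.mul_one]
  have hVz' : Vᴴ * SpinOperators.spinZ n * V = -spinX n := by
    have h : Vᴴ * (V * spinX n * Vᴴ) * V = spinX n := by
      calc Vᴴ * (V * spinX n * Vᴴ) * V = (Vᴴ * V) * spinX n * (Vᴴ * V) := by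
            simp only [Matrix.mul_assoc]
        _ = spinX n := by rw [hV', Matrix.one_mul, Matrix.mul_one]
    rw [hVx, Matrix.mul_neg, Matrix.neg_mul] at h
    calc Vᴴ * SpinOperators.spinZ n * V = -(-(Vᴴ * SpinOperators.spinZ n * V)) := (neg_neg _).symm
      _ = -spinX n := by rw [h]
  -- the product unitaries
  set U : Op (TorusSite d (2 * k)) (n + 1) := productOp u with hU
  set R : Op (TorusSite d (2 * k)) (n + 1) := productOp (fun _ : TorusSite d (2 * k) => V) with hR
  have hUU : U * Uᴴ = 1 := by rw [hU]; exact productOp_mul_conjTranspose hua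
  have hUU' : Uᴴ * U = 1 := by rw [hU]; exact productOp_conjTranspose_mul hua'
  have hRR : R * Rᴴ = 1 := by rw [hR]; exact productOp_mul_conjTranspose fun _ => hV
  have hRR' : Rᴴ * R = 1 := by rw [hR]; exact productOp_conjTranspose_mul fun _ => hV'
  set W : Op (TorusSite d (2 * k)) (n + 1) := R * U with hW
  have hWW : W * Wᴴ = 1 := by
    rw [hW, conjTranspose_mul, Matrix.mul_assoc, ← Matrix.mul_assoc U, hUU, Matrix.one_mul, hRR]
  have hWW' : Wᴴ * W = 1 := by
    rw [hW, conjTranspose_mul, Matrix.mul_assoc, ← Matrix.mul_assoc Rᴴ, hRR', Matrix.one_mul, hUU']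
  -- adjoint single-site actions of the product unitaries
  have hUadj : ∀ (x : TorusSite d (2 * k)) (α : Fin 3),
      Uᴴ * siteSpin n x α * U = (onSite x ((u x)ᴴ * spinVec n α * u x) : Op (TorusSite d (2 * k)) (n + 1)) := by
    intro x α
    have h1 : Uᴴ = productOp fun z => (u z)ᴴ := by rw [hU, productOp_conjTranspose]
    have h2 : U = (productOp fun z => (u z)ᴴ)ᴴ := by
      rw [productOp_conjTranspose]; simp only [conjTranspose_conjTranspose]; rfl
    rw [h1, h2]
    rw [productOp_conj_siteSpin (fun y => by rw [conjTranspose_conjTranspose]; exact hua' y)]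
    simp only [conjTranspose_conjTranspose]
  have hRadj : ∀ (x : TorusSite d (2 * k)) (α : Fin 3),
      Rᴴ * siteSpin n x α * R = (onSite x (Vᴴ * spinVec n α * V) : Op (TorusSite d (2 * k)) (n + 1)) := by
    intro x α
    have h1 : Rᴴ = productOp fun _ : TorusSite d (2 * k) => Vᴴ := by rw [hR, productOp_conjTranspose]
    have h2 : R = (productOp fun _ : TorusSite d (2 * k) => Vᴴ)ᴴ := by
      rw [productOp_conjTranspose]; simp only [conjTranspose_conjTranspose]; rfl
    rw [h1, h2]
    rw [productOp_conj_siteSpin (fun _ => by rw [conjTranspose_conjTranspose]; exact hV')]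
    simp only [conjTranspose_conjTranspose]
  have hWadj : ∀ A : Op (TorusSite d (2 * k)) (n + 1), Wᴴ * A * W = Uᴴ * (Rᴴ * A * R) * U := by
    intro A; rw [hW, conjTranspose_mul]; simp only [Matrix.mul_assoc]
  have hW0 : ∀ x, Wᴴ * siteSpin n x 0 * W = sgn x • siteSpin n x 2 := by
    intro x
    rw [hWadj, hRadj, spinVec_zero, hVx', show (onSite x (SpinOperators.spinZ n) :
      Op (TorusSite d (2 * k)) (n + 1)) = siteSpin n x 2 from rfl, hUadj, spinVec_two, huz',
      onSite_smul']
    rfl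
  have hW1 : ∀ x, Wᴴ * siteSpin n x 1 * W = sgn x • siteSpin n x 1 := by
    intro x
    rw [hWadj, hRadj, spinVec_one, hVy', show (onSite x (spinY n) :
      Op (TorusSite d (2 * k)) (n + 1)) = siteSpin n x 1 from rfl, hUadj, spinVec_one, huy',
      onSite_smul']
    rfl
  have hW2 : ∀ x, Wᴴ * siteSpin n x 2 * W = -siteSpin n x 0 := by
    intro x
    rw [hWadj, hRadj, spinVec_two, hVz', onSite_neg', show (onSite x (spinX n) :
      Op (TorusSite d (2 * k)) (n + 1)) = siteSpin n x 0 from rfl, Matrix.mul_neg, Matrix.neg_mul,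
      hUadj, spinVec_zero, hux']
    rfl
  have hWmul : ∀ A B : Op (TorusSite d (2 * k)) (n + 1),
      Wᴴ * (A * B) * W = (Wᴴ * A * W) * (Wᴴ * B * W) := by
    intro A B
    calc Wᴴ * (A * B) * W = Wᴴ * A * (W * Wᴴ) * B * W := by
          rw [hWW, Matrix.mul_one]; simp only [Matrix.mul_assoc]
      _ = (Wᴴ * A * W) * (Wᴴ * B * W) := by simp only [Matrix.mul_assoc]
  -- the Hamiltonians: `W H₀ Wᴴ = (-Δ) • H'`
  have hUconj : U * H₀ * Uᴴ = anisotropicTorus d (2 * k) n 1 (-1) (-Δ) := by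
    rw [hU, hH₀_def]
    exact sublatticeOp_conj_anisotropicTorus k hT hT' hTx hTy hTz 1 1 Δ
  have hRconj : ∀ a b c : ℝ, R * anisotropicTorus d (2 * k) n a b c * Rᴴ =
      anisotropicTorus d (2 * k) n c b a := by
    intro a b c
    rw [hR, globalOp_conj_anisotropicTorus hV hV' (γ := ![2, 1, 0]) (ε := ![-1, 1, 1])
      (fun α => by fin_cases α <;> simp) (fun α => by
        fin_cases α
        · simpa using hVx
        · simpa using hVy
        · simpa using hVz) a b c, anisotropicTorus_eq]
    rw [neg_inj]
    refine sum_congr rfl fun x _ => sum_congr rfl fun y _ => ?_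
    split_ifs
    · simp only [Matrix.cons_val_zero, Matrix.cons_val_one, Matrix.cons_val]
      abel
    · rfl
  have hscale : anisotropicTorus d (2 * k) n (-Δ) (-1) 1 = ((-Δ : ℝ) : ℂ) • H' := by
    have h := anisotropicTorus_mul_left (d := d) (2 * k) n (-Δ) 1 (-J) J
    rw [mul_one, mul_neg, hΔJ] at h
    rw [hH'_def, ← h]
  have hWconj : W * H₀ * Wᴴ = ((-Δ : ℝ) : ℂ) • H' := by
    rw [hW, conjTranspose_mul, show R * U * H₀ * (Uᴴ * Rᴴ) = R * (U * H₀ * Uᴴ) * Rᴴ by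
      simp only [Matrix.mul_assoc], hUconj, hRconj, hscale]
  -- covariance of the tracial ground state: `ω_{H'}(O) = ω_{H₀}(Wᴴ O W)`
  have hgsf : ∀ O : Op (TorusSite d (2 * k)) (n + 1),
      H'.groundStateFunctional O = H₀.groundStateFunctional (Wᴴ * O * W) := by
    intro O
    rw [← Matrix.groundStateFunctional_smul_of_pos hH' hΔ', ← hWconj]
    have hO : O = W * (Wᴴ * O * W) * Wᴴ := by
      calc O = (W * Wᴴ) * O * (W * Wᴴ) := by rw [hWW, Matrix.one_mul, Matrix.mul_one]
        _ = W * (Wᴴ * O * W) * Wᴴ := by simp only [Matrix.mul_assoc]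
    conv_lhs => rw [hO]
    exact Matrix.groundStateFunctional_unitary_conj hWW hWW' _
  -- the dictionary for the three correlation functions
  have hcorr0 : ∀ x y, xyzGroundCorr 0 (2 * k) n J (-J) x y =
      neelSign x * neelSign y * (H₀.groundStateFunctional (siteSpin n x 2 * siteSpin n y 2)).re := by
    intro x y
    rw [xyzGroundCorr_of_neZero, ← hH'_def, hgsf, hWmul, hW0, hW0, smul_mul_smul_comm, map_smul,
      hsgn_neel, hsgn_neel, smul_eq_mul, ← Complex.ofReal_mul, Complex.re_ofReal_mul]
  have hsgn_adj : ∀ (x : TorusSite d (2 * k)) (i : Fin d), sgn x * sgn (x + Pi.single i 1) = -1 := by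
    intro x i
    exact torusParity_sign_adj k (torusGraph_adj_add_single (2 * k) hL2 x i)
  have hcorr1 : ∀ (x : TorusSite d (2 * k)) (i : Fin d),
      xyzGroundCorr 1 (2 * k) n J (-J) x (x + Pi.single i 1) =
        -(H₀.groundStateFunctional (siteSpin n x 1 * siteSpin n (x + Pi.single i 1) 1)).re := by
    intro x i
    rw [xyzGroundCorr_of_neZero, ← hH'_def, hgsf, hWmul, hW1, hW1, smul_mul_smul_comm, hsgn_adj,
      map_smul, smul_eq_mul, neg_one_mul, Complex.neg_re]
  have hcorr2 : ∀ (x : TorusSite d (2 * k)) (i : Fin d),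
      xyzGroundCorr 2 (2 * k) n J (-J) x (x + Pi.single i 1) =
        (H₀.groundStateFunctional (siteSpin n x 0 * siteSpin n (x + Pi.single i 1) 0)).re := by
    intro x i
    rw [xyzGroundCorr_of_neZero, ← hH'_def, hgsf, hWmul, hW2, hW2, neg_mul_neg]
  -- Björnberg–Ueltschi: Gaussian domination ⇒ infrared bound, in the frame `H' = H(1, -J, J)`
  have hIR := xyz_infraredBound_of_groundEnergy_le (2 * k) n J (-J) hL3 hd
    (fun h => buSpinHalf_gaussianDomination (2 * k) n hEven hL4 hJ.le (by linarith) h) q hq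
  rw [xyzStructureFactor_of_neZero, xyzBondCorr_of_neZero, xyzBondCorr_of_neZero] at hIR
  simp only [hcorr0] at hIR
  simp only [hcorr1, hcorr2, Finset.sum_neg_distrib, neg_div] at hIR
  obtain ⟨h0, h1⟩ := hIR
  refine ⟨h0, h1.trans_eq ?_⟩
  -- the right-hand sides agree
  set A : ℝ := (∑ x : TorusSite d (2 * k), ∑ i : Fin d,
    (H₀.groundStateFunctional (siteSpin n x 1 * siteSpin n (x + Pi.single i 1) 1)).re) /
      ((d : ℝ) * ((2 * k : ℕ) : ℝ) ^ d) with hA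
  set B : ℝ := (∑ x : TorusSite d (2 * k), ∑ i : Fin d,
    (H₀.groundStateFunctional (siteSpin n x 0 * siteSpin n (x + Pi.single i 1) 0)).re) /
      ((d : ℝ) * ((2 * k : ℕ) : ℝ) ^ d) with hB
  have hsum : (∑ x : TorusSite d (2 * k), ∑ i : Fin d,
      (H₀.groundStateFunctional (siteSpin n x 0 * siteSpin n (x + Pi.single i 1) 0 +
        siteSpin n x 1 * siteSpin n (x + Pi.single i 1) 1)).re) /
        ((d : ℝ) * ((2 * k : ℕ) : ℝ) ^ d) = B + A := by
    simp only [map_add, Complex.add_re, Finset.sum_add_distrib, hA, hB, add_div]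
  rw [hsum, Finset.mul_sum, Finset.mul_sum]
  refine sum_congr rfl fun i _ => ?_
  rw [hJ_def]
  ring

/-- **The Ising-component infrared bound, momentum-shifted form.** With `Q = neelIndex (2k) = (π,…,π)`
and the plain `zz` structure factor `Ĉ(p) := |Λ|⁻¹ Σ_{x,y} cos(p·(x-y)) Re ω(Sᶻ_xSᶻ_y)` of the tracial
ground state of `anisotropicTorus d (2k) n 1 1 Δ`, `Δ < 0`: for every `q ≠ 0`,
`0 ≤ Ĉ(q + Q)` and `Ĉ(q + Q)² E(q) ≤ ((-Δ)⁻¹/4) c_∥ Σᵢ (1 + cos qᵢ)`, i.e. the density structure factor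
at `p = q + Q` is `O(E(p)^{1/2}) = O(|p|)` near `p = 0` (`E(q) = Σᵢ(1 + cos pᵢ) = 2d - E(p)` stays `≈ 2d`).
[cite: BjornbergUeltschi2022, Lemma 4.4 and Corollary 5.3] [cite: DysonLiebSimon1978, Theorem 4.2] -/
theorem xxz_isingStructureFactor_infraredBound (hd : 0 < d) (k : ℕ) [NeZero (2 * k)]
    (hk : 2 ≤ k) (n : ℕ) {Δ : ℝ} (hΔ : Δ < 0) (q : TorusSite d (2 * k)) (hq : q ≠ 0) :
    0 ≤ (∑ x : TorusSite d (2 * k), ∑ y : TorusSite d (2 * k),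
          Real.cos (torusPhase (2 * k) (q + neelIndex (2 * k)) (x - y)) *
            ((anisotropicTorus d (2 * k) n 1 1 Δ).groundStateFunctional
              (siteSpin n x 2 * siteSpin n y 2)).re) / ((2 * k : ℕ) : ℝ) ^ d ∧
    ((∑ x : TorusSite d (2 * k), ∑ y : TorusSite d (2 * k),
          Real.cos (torusPhase (2 * k) (q + neelIndex (2 * k)) (x - y)) *
            ((anisotropicTorus d (2 * k) n 1 1 Δ).groundStateFunctional
              (siteSpin n x 2 * siteSpin n y 2)).re) / ((2 * k : ℕ) : ℝ) ^ d) ^ 2 *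
        dispersion (latticeMomentum (2 * k) q) ≤
      ((-Δ)⁻¹ / 4) *
        ((∑ x : TorusSite d (2 * k), ∑ i : Fin d,
            ((anisotropicTorus d (2 * k) n 1 1 Δ).groundStateFunctional
              (siteSpin n x 0 * siteSpin n (x + Pi.single i 1) 0 +
                siteSpin n x 1 * siteSpin n (x + Pi.single i 1) 1)).re) /
          ((d : ℝ) * ((2 * k : ℕ) : ℝ) ^ d)) *
        ∑ i : Fin d, (1 + Real.cos (latticeMomentum (2 * k) q i)) := by
  have key : ∀ (x y : TorusSite d (2 * k)) (r : ℝ),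
      Real.cos (torusPhase (2 * k) (q + neelIndex (2 * k)) (x - y)) * r =
        Real.cos (torusPhase (2 * k) q (x - y)) * (neelSign x * neelSign y * r) := by
    intro x y r
    have h : Real.cos (torusPhase (2 * k) (q + neelIndex (2 * k)) (x - y)) =
        Real.cos (torusPhase (2 * k) q (x - y)) * (neelSign x * neelSign y) := by
      rw [← neelSign_mul_cos_torusPhase k q (x - y), mul_comm]
      congr 1
      rw [neelSign, ← cos_torusPhase_neelIndex k (x - y), cos_torusPhase_neelIndex_sub k x y]
      rfl
    rw [h, mul_assoc]
  simp only [key]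
  exact xxz_isingStagStructureFactor_infraredBound hd k hk n hΔ q hq

end Literature.MathematicalPhysics.QuantumLattice
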